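import Literature.AlgebraicGeometry.HodgeTheory.GysinBaseChangeOfKunneth
import Literature.AlgebraicGeometry.HodgeTheory.MotivatedClassesAlgebraic
import Literature.AlgebraicGeometry.HodgeTheory.AlgebraicClassesExteriorProduct

/-!
# Route NikulinTwinTransport · `SquareGlue` (stmt-HodgeConjecture-13682) — Künneth bookkeeping II:
# the correspondence-type classes of the special algebraic classes on a product

Helper file for the glue item `SquareGlue`. For smooth projective `Y`, `Z` (dimensions `m`, `n`),
an orientation family `μ` and a class `γ` on `(Y ⊗ Z)(ℂ)`, the bookkeeping reads `γ` through the
maps `w ↦ fst_*(snd^* w ∪ γ)` ("`[γ]_*`", the shape `Corr[…]` of the route's statements). This file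
computes them, from the tree's Gysin calculus alone (projection formula `complexGysin_cup`,
functoriality `complexGysin_comp` / `complexGysin_id`, the vanishing `complexGysin_cup_map_eq_zero_of_lt`,
associativity / graded commutativity / naturality of `∪`), for the classes the glue uses:

* `corrFst_mapFst_eq_zero_of_lt`, `corrFst_mapFst_of_fibreIntegral` — `γ = fst^* q`: zero on
  `Hʲ(Z(ℂ))` for `j < 2 dim Z`, and `w₀ ↦ κ • q` on a top class `w₀` with `fst_*(snd^* w₀) = κ • 1`;
* `corrFst_mapSnd` (+ `_eq_zero_of_lt`, `_of_cup_eq`) — `γ = snd^* a`: `w ↦ fst_*(snd^*(w ∪ a))`;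
* `corrFst_cross` (+ `_eq_zero_of_lt`, `_eq_zero_of_gt`, `_of_cup_eq`) — `γ = fst^* b ∪ snd^* a`
  (products of pulled-back classes, e.g. products of divisors): `w ↦ ± (coefficient of w ∪ a) κ • b`;
* `corrSnd_mapSnd_eq_zero_of_lt`, `corrSnd_mapSnd_of_fibreIntegral`, `corrSnd_mapFst` (+ `_eq_zero_of_lt`) —
  the symmetric statements for `b ↦ snd_*(fst^* b ∪ γ)`;
* `corrFst_diagonal` — `γ = Δ_* 1` the diagonal class of `X ⊗ X`: the identity in every degree
  (André 1996 §2.1 / the tree's `corrClassAction_graph` for `f = 𝟙`, in the `complexGysin` spelling);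
  `diagonal_mem_algebraicClasses` — it is algebraic (`complexGysin_graph_one_mem_algebraicClasses`);
* `map_fst_mem_algebraicClasses`, `map_snd_mem_algebraicClasses` — pull-backs of algebraic classes
  along the projections are algebraic (exterior products with `1`).

No new definitions, no named facts. Prover seat prover-pitem-stmt-HodgeConjecture-13682-0.
-/

noncomputable section

namespace Summit.HodgeConjecture.HodgeConjecture.Theorems.NikulinTwinTransport

open CategoryTheory MonoidalCategory CartesianMonoidalCategory
open Literature.AlgebraicGeometry.Motives Literature.AlgebraicGeometry.HodgeTheory
open Literature.AlgebraicTopology.SingularHomology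

variable {m n : ℕ} {Y Z : SchemeOver ℂ}

/-! ### `γ = fst^* q` -/

/-- **`fst_*(snd^* w ∪ fst^* q) = 0` for `deg w < 2 dim Z`**: after the swap
`snd^* w ∪ fst^* q = ± fst^* q ∪ snd^* w` this is `f_*(f^* u ∪ v) = 0` for `deg v < 2 (dim (Y ⊗ Z) - dim Y)`
(`complexGysin_cup_map_eq_zero_of_lt`). [cite: FultonYoungTableaux1997, Appendix B §B.1 (5)–(6)] -/
theorem corrFst_mapFst_eq_zero_of_lt (μ : OrientationFamily)
    (hY : IsSmoothProjective m Y) (hZ : IsSmoothProjective n Z) {j k' a b : ℕ}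
    (hja : j + k' = a) (hab : a + 2 * m = b + 2 * (m + n)) (hj : j < 2 * n)
    (w : complexBetti Z j) (q : complexBetti Y k') :
    complexGysin μ (IsSmoothProjective.tensor_holds hY hZ) hY (fst Y Z) hab
        (cupProduct hja (complexBetti.map (snd Y Z) j w) (complexBetti.map (fst Y Z) k' q)) = 0 := by
  have hkj : k' + j = a := by omega
  rw [cupProduct_gradedComm_holds ℂ _ hja hkj, map_smul,
    complexGysin_cup_map_eq_zero_of_lt (IsSmoothProjective.tensor_holds hY hZ) hY (fst Y Z) hkj hab
      (by omega) q, smul_zero]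

/-- **`fst_*(snd^* w₀ ∪ fst^* q) = κ • q` when `fst_*(snd^* w₀) = κ • 1`** (`w₀` a top class of `Z`):
the swap `snd^* w₀ ∪ fst^* q = fst^* q ∪ snd^* w₀` (even degree) and the projection formula
`fst_*(fst^* q ∪ snd^* w₀) = q ∪ fst_*(snd^* w₀) = q ∪ κ • 1`. [cite: FultonYoungTableaux1997, Appendix B §B.1 (3) and (6)] -/
theorem corrFst_mapFst_of_fibreIntegral (μ : OrientationFamily)
    (hY : IsSmoothProjective m Y) (hZ : IsSmoothProjective n Z) {k' a : ℕ}
    (hja : 2 * n + k' = a) (hab : a + 2 * m = k' + 2 * (m + n)) (hdeg : 2 * n + 2 * m = 0 + 2 * (m + n))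
    {κ : ℂ} {w₀ : complexBetti Z (2 * n)}
    (hκ : complexGysin μ (IsSmoothProjective.tensor_holds hY hZ) hY (fst Y Z) hdeg
      (complexBetti.map (snd Y Z) (2 * n) w₀) = κ • singularCohomology.one ℂ (ComplexPoints Y))
    (q : complexBetti Y k') :
    complexGysin μ (IsSmoothProjective.tensor_holds hY hZ) hY (fst Y Z) hab
        (cupProduct hja (complexBetti.map (snd Y Z) (2 * n) w₀) (complexBetti.map (fst Y Z) k' q)) =
      κ • q := by
  have hkj : k' + 2 * n = a := by omega
  rw [cupProduct_gradedComm_holds ℂ _ hja hkj, map_smul,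
    complexGysin_cup (μ.hasPoincareDuality) (IsSmoothProjective.tensor_holds hY hZ) hY (fst Y Z) hkj hab
      hdeg (Nat.add_zero k') q, hκ, map_smul, cupProduct_one]
  have hsign : ((-1 : ℂ) ^ (2 * n * k')) = 1 := by
    rw [mul_assoc, pow_mul, neg_one_sq, one_pow]
  rw [hsign, one_smul]

/-! ### `γ = snd^* a` -/

/-- **`fst_*(snd^* w ∪ snd^* a) = fst_*(snd^*(w ∪ a))`** (naturality of `∪`). [cite: HatcherAT2002, §3.2 Prop. 3.10] -/
theorem corrFst_mapSnd (μ : OrientationFamily)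
    (hY : IsSmoothProjective m Y) (hZ : IsSmoothProjective n Z) {j k' a b : ℕ}
    (hja : j + k' = a) (hab : a + 2 * m = b + 2 * (m + n))
    (w : complexBetti Z j) (a' : complexBetti Z k') :
    complexGysin μ (IsSmoothProjective.tensor_holds hY hZ) hY (fst Y Z) hab
        (cupProduct hja (complexBetti.map (snd Y Z) j w) (complexBetti.map (snd Y Z) k' a')) =
      complexGysin μ (IsSmoothProjective.tensor_holds hY hZ) hY (fst Y Z) hab
        (complexBetti.map (snd Y Z) a (cupProduct hja w a')) := by
  rw [complexBetti.map, complexBetti.map, complexBetti.map, cupProduct_map]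

/-- `fst_*(snd^* w ∪ snd^* a) = 0` when `deg w + deg a > 2 dim Z` (then `w ∪ a = 0`).
[cite: HatcherAT2002, §3.3 Thm. 3.26] -/
theorem corrFst_mapSnd_eq_zero_of_lt (μ : OrientationFamily)
    (hY : IsSmoothProjective m Y) (hZ : IsSmoothProjective n Z) {j k' a b : ℕ}
    (hja : j + k' = a) (hab : a + 2 * m = b + 2 * (m + n)) (hlt : 2 * n < a)
    (w : complexBetti Z j) (a' : complexBetti Z k') :
    complexGysin μ (IsSmoothProjective.tensor_holds hY hZ) hY (fst Y Z) hab
        (cupProduct hja (complexBetti.map (snd Y Z) j w) (complexBetti.map (snd Y Z) k' a')) = 0 := by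
  haveI := subsingleton_complexBetti hZ hlt
  rw [corrFst_mapSnd μ hY hZ, Subsingleton.elim (cupProduct hja w a') 0, map_zero, map_zero]

/-- `fst_*(snd^* w ∪ snd^* a) = t κ • 1` when `w ∪ a = t • w₀` and `fst_*(snd^* w₀) = κ • 1`.
[cite: FultonYoungTableaux1997, Appendix B §B.1 (5)] -/
theorem corrFst_mapSnd_of_cup_eq (μ : OrientationFamily)
    (hY : IsSmoothProjective m Y) (hZ : IsSmoothProjective n Z) {j k' : ℕ}
    (hja : j + k' = 2 * n) (hdeg : 2 * n + 2 * m = 0 + 2 * (m + n))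
    {κ : ℂ} {w₀ : complexBetti Z (2 * n)}
    (hκ : complexGysin μ (IsSmoothProjective.tensor_holds hY hZ) hY (fst Y Z) hdeg
      (complexBetti.map (snd Y Z) (2 * n) w₀) = κ • singularCohomology.one ℂ (ComplexPoints Y))
    {w : complexBetti Z j} {a' : complexBetti Z k'} {t : ℂ} (hwa : cupProduct hja w a' = t • w₀) :
    complexGysin μ (IsSmoothProjective.tensor_holds hY hZ) hY (fst Y Z) hdeg
        (cupProduct hja (complexBetti.map (snd Y Z) j w) (complexBetti.map (snd Y Z) k' a')) =
      (t * κ) • singularCohomology.one ℂ (ComplexPoints Y) := by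
  rw [corrFst_mapSnd μ hY hZ, hwa, map_smul, map_smul, hκ, smul_smul]

/-! ### `γ = fst^* b ∪ snd^* a` (products of pulled-back classes) -/

/-- **Master identity for products of pulled-back classes**:
`fst_*(snd^* w ∪ (fst^* b ∪ snd^* a)) = (-1)^{ji} • fst_*(fst^* b ∪ snd^*(w ∪ a))`
(`deg w = j`, `deg b = i`; associativity, graded commutativity and naturality of `∪`).
[cite: HatcherAT2002, §3.2 Prop. 3.10 and Thm. 3.11] -/
theorem corrFst_cross (μ : OrientationFamily)
    (hY : IsSmoothProjective m Y) (hZ : IsSmoothProjective n Z) {i j k' s e a b' : ℕ}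
    (his : i + k' = s) (hja : j + s = a) (hjk : j + k' = e) (hie : i + e = a)
    (hab : a + 2 * m = b' + 2 * (m + n))
    (w : complexBetti Z j) (b : complexBetti Y i) (a' : complexBetti Z k') :
    complexGysin μ (IsSmoothProjective.tensor_holds hY hZ) hY (fst Y Z) hab
        (cupProduct hja (complexBetti.map (snd Y Z) j w)
          (cupProduct his (complexBetti.map (fst Y Z) i b) (complexBetti.map (snd Y Z) k' a'))) =
      (-1 : ℂ) ^ (j * i) • complexGysin μ (IsSmoothProjective.tensor_holds hY hZ) hY (fst Y Z) hab
        (cupProduct hie (complexBetti.map (fst Y Z) i b)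
          (complexBetti.map (snd Y Z) e (cupProduct hjk w a'))) := by
  have hm' : j + i + k' = a := by omega
  have hij' : i + j = j + i := Nat.add_comm i j
  rw [← cupProduct_assoc (rfl : j + i = j + i) his hm' hja,
    cupProduct_gradedComm_holds ℂ _ (rfl : j + i = j + i) hij', LinearMap.map_smul₂, map_smul,
    cupProduct_assoc hij' hjk hm' hie, complexBetti.map, complexBetti.map, complexBetti.map,
    cupProduct_map]

/-- `fst_*(snd^* w ∪ (fst^* b ∪ snd^* a)) = 0` when `deg w + deg a < 2 dim Z` (below the fibre
dimension, `complexGysin_cup_map_eq_zero_of_lt`). [cite: FultonYoungTableaux1997, Appendix B §B.1 (5)–(6)] -/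
theorem corrFst_cross_eq_zero_of_lt (μ : OrientationFamily)
    (hY : IsSmoothProjective m Y) (hZ : IsSmoothProjective n Z) {i j k' s a b' : ℕ}
    (his : i + k' = s) (hja : j + s = a) (hab : a + 2 * m = b' + 2 * (m + n)) (hlt : j + k' < 2 * n)
    (w : complexBetti Z j) (b : complexBetti Y i) (a' : complexBetti Z k') :
    complexGysin μ (IsSmoothProjective.tensor_holds hY hZ) hY (fst Y Z) hab
        (cupProduct hja (complexBetti.map (snd Y Z) j w)
          (cupProduct his (complexBetti.map (fst Y Z) i b) (complexBetti.map (snd Y Z) k' a'))) = 0 := by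
  rw [corrFst_cross μ hY hZ his hja rfl (by omega) hab,
    complexGysin_cup_map_eq_zero_of_lt (IsSmoothProjective.tensor_holds hY hZ) hY (fst Y Z) _ hab
      (by omega) b, smul_zero]

/-- `fst_*(snd^* w ∪ (fst^* b ∪ snd^* a)) = 0` when `deg w + deg a > 2 dim Z` (then `w ∪ a = 0`).
[cite: HatcherAT2002, §3.3 Thm. 3.26] -/
theorem corrFst_cross_eq_zero_of_gt (μ : OrientationFamily)
    (hY : IsSmoothProjective m Y) (hZ : IsSmoothProjective n Z) {i j k' s a b' : ℕ}
    (his : i + k' = s) (hja : j + s = a) (hab : a + 2 * m = b' + 2 * (m + n)) (hgt : 2 * n < j + k')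
    (w : complexBetti Z j) (b : complexBetti Y i) (a' : complexBetti Z k') :
    complexGysin μ (IsSmoothProjective.tensor_holds hY hZ) hY (fst Y Z) hab
        (cupProduct hja (complexBetti.map (snd Y Z) j w)
          (cupProduct his (complexBetti.map (fst Y Z) i b) (complexBetti.map (snd Y Z) k' a'))) = 0 := by
  haveI := subsingleton_complexBetti hZ hgt
  rw [corrFst_cross μ hY hZ his hja rfl (by omega) hab, Subsingleton.elim (cupProduct rfl w a') 0,
    map_zero, map_zero, map_zero, smul_zero]

/-- **`fst_*(snd^* w ∪ (fst^* b ∪ snd^* a)) = (-1)^{ji} t κ • b` when `w ∪ a = t • w₀` is a top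
class of `Z` and `fst_*(snd^* w₀) = κ • 1`** — the rank-one map `w ↦ (w.a) b` of a product of
pulled-back classes (e.g. a product of divisors, Fulton §16.1), by the projection formula.
[cite: Fulton1998, §16.1] [cite: FultonYoungTableaux1997, Appendix B §B.1 (3) and (6)] -/
theorem corrFst_cross_of_cup_eq (μ : OrientationFamily)
    (hY : IsSmoothProjective m Y) (hZ : IsSmoothProjective n Z) {i j k' s a : ℕ}
    (his : i + k' = s) (hja : j + s = a) (hjk : j + k' = 2 * n) (hab : a + 2 * m = i + 2 * (m + n))
    (hdeg : 2 * n + 2 * m = 0 + 2 * (m + n))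
    {κ : ℂ} {w₀ : complexBetti Z (2 * n)}
    (hκ : complexGysin μ (IsSmoothProjective.tensor_holds hY hZ) hY (fst Y Z) hdeg
      (complexBetti.map (snd Y Z) (2 * n) w₀) = κ • singularCohomology.one ℂ (ComplexPoints Y))
    {w : complexBetti Z j} (b : complexBetti Y i) {a' : complexBetti Z k'} {t : ℂ}
    (hwa : cupProduct hjk w a' = t • w₀) :
    complexGysin μ (IsSmoothProjective.tensor_holds hY hZ) hY (fst Y Z) hab
        (cupProduct hja (complexBetti.map (snd Y Z) j w)
          (cupProduct his (complexBetti.map (fst Y Z) i b) (complexBetti.map (snd Y Z) k' a'))) =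
      ((-1 : ℂ) ^ (j * i) * (t * κ)) • b := by
  rw [corrFst_cross μ hY hZ his hja hjk (by omega) hab, hwa, map_smul, map_smul, map_smul,
    complexGysin_cup (μ.hasPoincareDuality) (IsSmoothProjective.tensor_holds hY hZ) hY (fst Y Z) _ hab
      hdeg (Nat.add_zero i) b, hκ, map_smul, cupProduct_one, smul_smul, smul_smul, mul_assoc]

/-! ### The symmetric statements for the second projection -/

/-- **`snd_*(fst^* b ∪ snd^* q) = 0` for `deg b < 2 dim Y`** (swap, then `f_*(f^* u ∪ v) = 0` below the
fibre dimension). [cite: FultonYoungTableaux1997, Appendix B §B.1 (5)–(6)] -/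
theorem corrSnd_mapSnd_eq_zero_of_lt (μ : OrientationFamily)
    (hY : IsSmoothProjective m Y) (hZ : IsSmoothProjective n Z) {i k' a b : ℕ}
    (hia : i + k' = a) (hab : a + 2 * n = b + 2 * (m + n)) (hi : i < 2 * m)
    (b' : complexBetti Y i) (q : complexBetti Z k') :
    complexGysin μ (IsSmoothProjective.tensor_holds hY hZ) hZ (snd Y Z) hab
        (cupProduct hia (complexBetti.map (fst Y Z) i b') (complexBetti.map (snd Y Z) k' q)) = 0 := by
  have hki : k' + i = a := by omega
  rw [cupProduct_gradedComm_holds ℂ _ hia hki, map_smul,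
    complexGysin_cup_map_eq_zero_of_lt (IsSmoothProjective.tensor_holds hY hZ) hZ (snd Y Z) hki hab
      (by omega) q, smul_zero]

/-- **`snd_*(fst^* ω₀ ∪ snd^* q) = κ • q` when `snd_*(fst^* ω₀) = κ • 1`** (`ω₀` a top class of `Y`;
swap and projection formula for `snd`). [cite: FultonYoungTableaux1997, Appendix B §B.1 (3) and (6)] -/
theorem corrSnd_mapSnd_of_fibreIntegral (μ : OrientationFamily)
    (hY : IsSmoothProjective m Y) (hZ : IsSmoothProjective n Z) {k' a : ℕ}
    (hia : 2 * m + k' = a) (hab : a + 2 * n = k' + 2 * (m + n)) (hdeg : 2 * m + 2 * n = 0 + 2 * (m + n))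
    {κ : ℂ} {ω₀ : complexBetti Y (2 * m)}
    (hκ : complexGysin μ (IsSmoothProjective.tensor_holds hY hZ) hZ (snd Y Z) hdeg
      (complexBetti.map (fst Y Z) (2 * m) ω₀) = κ • singularCohomology.one ℂ (ComplexPoints Z))
    (q : complexBetti Z k') :
    complexGysin μ (IsSmoothProjective.tensor_holds hY hZ) hZ (snd Y Z) hab
        (cupProduct hia (complexBetti.map (fst Y Z) (2 * m) ω₀) (complexBetti.map (snd Y Z) k' q)) =
      κ • q := by
  have hkm : k' + 2 * m = a := by omega
  rw [cupProduct_gradedComm_holds ℂ _ hia hkm, map_smul,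
    complexGysin_cup (μ.hasPoincareDuality) (IsSmoothProjective.tensor_holds hY hZ) hZ (snd Y Z) hkm hab
      hdeg (Nat.add_zero k') q, hκ, map_smul, cupProduct_one]
  have hsign : ((-1 : ℂ) ^ (2 * m * k')) = 1 := by
    rw [mul_assoc, pow_mul, neg_one_sq, one_pow]
  rw [hsign, one_smul]

/-- **`snd_*(fst^* b ∪ fst^* a) = snd_*(fst^*(b ∪ a))`** (naturality of `∪`). [cite: HatcherAT2002, §3.2 Prop. 3.10] -/
theorem corrSnd_mapFst (μ : OrientationFamily)
    (hY : IsSmoothProjective m Y) (hZ : IsSmoothProjective n Z) {i k' a b : ℕ}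
    (hia : i + k' = a) (hab : a + 2 * n = b + 2 * (m + n))
    (b' : complexBetti Y i) (a' : complexBetti Y k') :
    complexGysin μ (IsSmoothProjective.tensor_holds hY hZ) hZ (snd Y Z) hab
        (cupProduct hia (complexBetti.map (fst Y Z) i b') (complexBetti.map (fst Y Z) k' a')) =
      complexGysin μ (IsSmoothProjective.tensor_holds hY hZ) hZ (snd Y Z) hab
        (complexBetti.map (fst Y Z) a (cupProduct hia b' a')) := by
  rw [complexBetti.map, complexBetti.map, complexBetti.map, cupProduct_map]

/-- `snd_*(fst^* b ∪ fst^* a) = 0` when `deg b + deg a > 2 dim Y` (then `b ∪ a = 0`).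
[cite: HatcherAT2002, §3.3 Thm. 3.26] -/
theorem corrSnd_mapFst_eq_zero_of_lt (μ : OrientationFamily)
    (hY : IsSmoothProjective m Y) (hZ : IsSmoothProjective n Z) {i k' a b : ℕ}
    (hia : i + k' = a) (hab : a + 2 * n = b + 2 * (m + n)) (hlt : 2 * m < a)
    (b' : complexBetti Y i) (a' : complexBetti Y k') :
    complexGysin μ (IsSmoothProjective.tensor_holds hY hZ) hZ (snd Y Z) hab
        (cupProduct hia (complexBetti.map (fst Y Z) i b') (complexBetti.map (fst Y Z) k' a')) = 0 := by
  haveI := subsingleton_complexBetti hY hlt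
  rw [corrSnd_mapFst μ hY hZ, Subsingleton.elim (cupProduct hia b' a') 0, map_zero, map_zero]

/-! ### Pull-backs of algebraic classes along the projections -/

/-- **Pull-backs along `pr₂` of algebraic classes are algebraic**: `pr₂^* b = pr₁^* 1 ∪ pr₂^* b` is an
exterior product with `1 ∈ N⁰H⁰` (`cupProduct_map_fst_map_snd_mem_supportedClasses`).
[cite: VoisinHodgeII2003, proof of Prop. 9.20 (first display)] -/
theorem map_snd_mem_algebraicClasses {m n : ℕ} {Y Z : SchemeOver ℂ} (hY : IsSmoothProjective m Y)
    (hZ : IsSmoothProjective n Z) {k : ℕ} {b : complexBetti Z (2 * k)} (hb : b ∈ algebraicClasses Z k) :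
    complexBetti.map (snd Y Z) (2 * k) b ∈ algebraicClasses (Y ⊗ Z) k := by
  have h := cupProduct_map_fst_map_snd_mem_supportedClasses hY hZ (Nat.zero_add (2 * k)) (r := 0)
    (a := singularCohomology.one ℂ (ComplexPoints Y)) (by rw [supportedClasses_zero]; exact Submodule.mem_top) hb
  rw [show complexBetti.map (fst Y Z) 0 (singularCohomology.one ℂ (ComplexPoints Y)) =
      singularCohomology.one ℂ (ComplexPoints (Y ⊗ Z)) from singularCohomology.map_one _,
    one_cupProduct, Nat.zero_add] at h
  exact h

/-- **Pull-backs along `pr₁` of algebraic classes are algebraic**: `pr₁^* a = pr₁^* a ∪ pr₂^* 1`.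
[cite: VoisinHodgeII2003, proof of Prop. 9.20 (first display)] -/
theorem map_fst_mem_algebraicClasses {m n : ℕ} {Y Z : SchemeOver ℂ} (hY : IsSmoothProjective m Y)
    (hZ : IsSmoothProjective n Z) {k : ℕ} {a : complexBetti Y (2 * k)} (ha : a ∈ algebraicClasses Y k) :
    complexBetti.map (fst Y Z) (2 * k) a ∈ algebraicClasses (Y ⊗ Z) k := by
  have h := cupProduct_map_fst_map_snd_mem_supportedClasses hY hZ (Nat.add_zero (2 * k)) (s := 0)
    (b := singularCohomology.one ℂ (ComplexPoints Z)) ha (by rw [supportedClasses_zero]; exact Submodule.mem_top)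
  rw [show complexBetti.map (snd Y Z) 0 (singularCohomology.one ℂ (ComplexPoints Z)) =
      singularCohomology.one ℂ (ComplexPoints (Y ⊗ Z)) from singularCohomology.map_one _,
    cupProduct_one, Nat.add_zero] at h
  exact h

/-! ### The diagonal class -/

section Diagonal

variable {X : SchemeOver ℂ}

/-- **The diagonal class `Δ_* 1 ∈ H^{2 dim X}((X ⊗ X)(ℂ); ℂ)` is algebraic** (`Δ = (𝟙, 𝟙)`, the graph
of the identity; `complexGysin_graph_one_mem_algebraicClasses`). [cite: Andre1996Motifs, §2.1 (p. 15)]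
[cite: FultonYoungTableaux1997, Appendix B §B.3] -/
theorem diagonal_mem_algebraicClasses (μ : OrientationFamily) (hX : IsSmoothProjective m X)
    (hdeg : 0 + 2 * (m + m) = 2 * m + 2 * m) :
    complexGysin μ hX (IsSmoothProjective.tensor_holds hX hX) (lift (𝟙 X) (𝟙 X)) hdeg
        (singularCohomology.one ℂ (ComplexPoints X)) ∈ algebraicClasses (X ⊗ X) m :=
  complexGysin_graph_one_mem_algebraicClasses μ μ.hasPoincareDuality hX
    (IsSmoothProjective.tensor_holds hX hX) (𝟙 X)

/-- **The diagonal class acts as the identity: `fst_*(snd^* w ∪ Δ_* 1) = w`** in every degree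
(with `g = (𝟙, 𝟙)`: `snd^* w ∪ g_* 1 = g_*(g^* snd^* w ∪ 1) = g_* w` by the projection formula and
`g ≫ snd = 𝟙`, and `fst_* g_* = (g ≫ fst)_* = 𝟙_* = id`; André 1996 §2.1, the tree's
`corrClassAction_graph` for `f = 𝟙` in the `complexGysin` spelling). [cite: Andre1996Motifs, §2.1 (p. 15)]
[cite: FultonYoungTableaux1997, Appendix B §B.1 (2), (5), (6)] -/
theorem corrFst_diagonal (μ : OrientationFamily) (hX : IsSmoothProjective m X) {j a : ℕ}
    (hja : j + 2 * m = a) (hab : a + 2 * m = j + 2 * (m + m)) (hdeg : 0 + 2 * (m + m) = 2 * m + 2 * m)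
    (w : complexBetti X j) :
    complexGysin μ (IsSmoothProjective.tensor_holds hX hX) hX (fst X X) hab
        (cupProduct hja (complexBetti.map (snd X X) j w)
          (complexGysin μ hX (IsSmoothProjective.tensor_holds hX hX) (lift (𝟙 X) (𝟙 X)) hdeg
            (singularCohomology.one ℂ (ComplexPoints X)))) = w := by
  have hμ := μ.hasPoincareDuality
  have hXX := IsSmoothProjective.tensor_holds hX hX
  -- projection formula for `g = (𝟙, 𝟙)`
  rw [← complexGysin_cup hμ hX hXX (lift (𝟙 X) (𝟙 X)) (Nat.add_zero j)
    (show j + 2 * (m + m) = a + 2 * m by omega) hdeg hja, cupProduct_one]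
  -- `g^* snd^* = (g ≫ snd)^* = 𝟙^*`
  have hgs : complexBetti.map (lift (𝟙 X) (𝟙 X)) j (complexBetti.map (snd X X) j w) = w := by
    rw [← CategoryTheory.comp_apply, ← complexBetti.map_comp, lift_snd, complexBetti.map_id,
      CategoryTheory.id_apply]
  rw [hgs]
  -- `fst_* ∘ g_* = (g ≫ fst)_* = 𝟙_* = id`
  have hcomp := complexGysin_comp hμ hX hXX hX (lift (𝟙 X) (𝟙 X)) (fst X X)
    (show j + 2 * (m + m) = a + 2 * m by omega) hab
  rw [lift_fst, complexGysin_id hμ hX j] at hcomp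
  have h := LinearMap.congr_fun hcomp w
  rw [LinearMap.comp_apply, LinearMap.id_apply] at h
  exact h.symm

end Diagonal

end Summit.HodgeConjecture.HodgeConjecture.Theorems.NikulinTwinTransport

end
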